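import Summits.QuantumFields.YangMills.Theorems.SwapVirialDeficitZeroModeExactPairFormula
import HarnessLib

/-!
# Zero-mode EXACT rung Z2-b: the full distribution function of `re(q u)` — `Haar{u | re(q u) ≤ x} = 1 − (arccos x − x√(1−x²))/π` for EVERY real `x`
# (free-hands support of crux ⟨stmt-QuantumFields-24197⟩ `SwapVirialDeficit.SwapGluedStiffness`; item Z2 of fcl-p3 g43's zero-mode exact rung plan,
# completing ✓`haar_re_ge_eq` (file `…RealPart`, the cap `x ∈ (0,1]`) to all of `ℝ`)

* §24 the TAIL of the gnomonic density, `∫_{r>R} r²(1+r²)⁻² dr = π/4 − (arctan R − R/(1+R²))/2` (improper FTC, ✓`integral_Ioi_of_hasDerivAt_of_tendsto'`),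
  in particular `∫_{ℝ³}(1+|v|²)⁻² dv = π²` (each gnomonic hemisphere has Haar mass `1/2`);
* §25 level sets are null: `Haar{re(q u) = x} = 0` (in the chart a level set is a sphere `|v|² = x⁻² − 1`, radially a finite set);
* §26 ★★ `haar_re_gt_eq`: `Haar{u | x < re(q u)} = (arccos x − x√(1−x²))/π` for ALL `x : ℝ` (five regimes: `x < −1`, `[−1,0)` via the lower-hemisphere
  tail, `x = 0` (mass `1/2`), `(0,1]` via the cap ✓`haar_re_ge_eq_ofReal` and §25, `x > 1`; Mathlib's `arccos`/`√·` conventions make ONE formula valid on `ℝ`),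
  ★★ `haar_re_le_eq`: `Haar{re(q u) ≤ x} = 1 − (arccos x − x√(1−x²))/π` — the SEMICIRCLE distribution function; file Z2-c identifies the law
  `(2/π)√(1−s²)ds` from it.

HONEST LABEL: exact finite-dimensional Haar identities (plan-level zero-mode rung of a DRAFT line); NOT the fixed-`L` sharp law, NOT ⟨24197⟩; no rung /
summit statement is proved; the Yang–Mills mass gap is NOT proved; no summit is proved by a line.  Width seat ym-line-sfw-p2-w3 g62 (cell ym-idea-1,
free hands; own crux ⟨22884⟩ blocked-on ⟨19935⟩), `--supports stmt-QuantumFields-24197`.  THEOREMS ONLY, standard axioms, 0 `sorry`.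
References: [cite: Chatterjee2026YMHiggs, Lemma 5.1 / Cor. 5.2]; [folklore] (Sato–Tate / semicircle law on `SU(2)`).
-/

set_option autoImplicit false

noncomputable section

open MeasureTheory Quaternion Set Real Filter
open scoped Quaternion ENNReal BigOperators Topology
open Literature.MathematicalPhysics.QuantumLattice
open Literature.MathematicalPhysics.QuantumFieldTheory (haarProbability)
open Literature.MathematicalPhysics.QuantumFieldTheory.Balaban1983to89.T4HaarSU2Translate (su2Quat_quatToSU2 measurable_su2Quat
  continuous_su2Quat)
open Summit.QuantumFields.YangMills.Theorems.SwapTwistDeficit.ToronLog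
open Summit.QuantumFields.YangMills.Theorems.ToronValleyVolume.NearlyCommutingCeiling (sq_norm_im_eq)

attribute [local instance] Literature.Analysis.FluidPDE.Tao2016.quatMeasurableSpace
  Literature.Analysis.FluidPDE.Tao2016.quatBorelSpace
  Literature.MathematicalPhysics.QuantumLattice.secondCountableTopology_su2

namespace Summit.QuantumFields.YangMills.Theorems.SwapVirialDeficit.ZeroModeExact

/-! ## §24 The tail of the gnomonic density -/

/-- `(arctan r − r(1+r²)⁻¹)/2 → π/4` as `r → ∞`. [folklore] -/
theorem tendsto_cap_antideriv :
    Tendsto (fun r : ℝ => (Real.arctan r - r * (1 + r ^ 2)⁻¹) / 2) atTop (𝓝 (Real.pi / 4)) := by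
  have h1 : Tendsto Real.arctan atTop (𝓝 (Real.pi / 2)) := tendsto_nhds_of_tendsto_nhdsWithin Real.tendsto_arctan_atTop
  have h2 : Tendsto (fun r : ℝ => r * (1 + r ^ 2)⁻¹) atTop (𝓝 0) := by
    -- squeeze between `0` and `r⁻¹`
    refine tendsto_of_tendsto_of_tendsto_of_le_of_le' tendsto_const_nhds tendsto_inv_atTop_zero ?_ ?_
    · filter_upwards [eventually_ge_atTop (0 : ℝ)] with r hr; positivity
    · filter_upwards [eventually_gt_atTop (0 : ℝ)] with r hr
      rw [← div_eq_mul_inv, div_le_iff₀ (by positivity)]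
      have : r⁻¹ * (1 + r ^ 2) = r⁻¹ + r := by field_simp
      rw [this]; linarith [inv_pos.2 hr]
  have := (h1.sub h2).div_const 2
  rw [show (Real.pi / 2 - 0) / 2 = Real.pi / 4 by ring] at this
  exact this

/-- The tail integrand is dominated by `(1+r²)⁻¹`. [folklore] -/
theorem cap_integrand_le (r : ℝ) : r ^ 2 * ((1 + r ^ 2)⁻¹) ^ 2 ≤ (1 + r ^ 2)⁻¹ := by
  have h1 : 0 < 1 + r ^ 2 := by positivity
  rw [inv_pow, show r ^ 2 * ((1 + r ^ 2) ^ 2)⁻¹ = (r ^ 2 / (1 + r ^ 2)) * (1 + r ^ 2)⁻¹ by field_simp]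
  refine mul_le_of_le_one_left (inv_nonneg.2 h1.le) ?_
  rw [div_le_one h1]; linarith [sq_nonneg r]

/-- ★ **TAIL INTEGRAL**: `∫_{r>R} r²·((1+r²)⁻¹)² dr = π/4 − (arctan R − R/(1+R²))/2`. [folklore] -/
theorem integral_cap_Ioi (R : ℝ) :
    ∫ r in Ioi R, r ^ 2 * ((1 + r ^ 2)⁻¹) ^ 2 = Real.pi / 4 - (Real.arctan R - R * (1 + R ^ 2)⁻¹) / 2 := by
  have hcont : Continuous fun r : ℝ => r ^ 2 * ((1 + r ^ 2)⁻¹) ^ 2 :=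
    (continuous_pow 2).mul ((Continuous.inv₀ (by fun_prop) fun x => by positivity).pow 2)
  have hint : IntegrableOn (fun r : ℝ => r ^ 2 * ((1 + r ^ 2)⁻¹) ^ 2) (Ioi R) := by
    refine (integrable_inv_one_add_sq.integrableOn).mono' hcont.aestronglyMeasurable (Filter.Eventually.of_forall fun r => ?_)
    rw [Real.norm_eq_abs, abs_of_nonneg (by positivity)]
    exact cap_integrand_le r
  rw [integral_Ioi_of_hasDerivAt_of_tendsto' (fun x _ => hasDerivAt_cap x) hint tendsto_cap_antideriv]

/-- As a lower integral over `(0,∞)` with the cut-off `r² > S` (`S ≥ 0`):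
`∫_{r>0} r²·𝟙{S < r²}·((1+r²)⁻¹)² = π/4 − (arctan √S − √S/(1+S))/2`. [folklore] -/
theorem lintegral_tail_cutoff {S : ℝ} (hS : 0 ≤ S) :
    ∫⁻ r in Ioi (0 : ℝ), ENNReal.ofReal (r ^ 2) * (Set.Ioi S).indicator (fun s : ℝ => ENNReal.ofReal (((1 + s)⁻¹) ^ 2)) (r ^ 2) =
      ENNReal.ofReal (Real.pi / 4 - (Real.arctan (Real.sqrt S) - Real.sqrt S * (1 + S)⁻¹) / 2) := by
  have hsqrt : Real.sqrt S ^ 2 = S := Real.sq_sqrt hS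
  have hpt : ∀ r ∈ Ioi (0 : ℝ), ENNReal.ofReal (r ^ 2) * (Set.Ioi S).indicator (fun s : ℝ => ENNReal.ofReal (((1 + s)⁻¹) ^ 2)) (r ^ 2) =
      (Set.Ioi (Real.sqrt S)).indicator (fun r : ℝ => ENNReal.ofReal (r ^ 2 * ((1 + r ^ 2)⁻¹) ^ 2)) r := by
    intro r hr
    have hr' : (0 : ℝ) < r := hr
    by_cases h : r ^ 2 ∈ Set.Ioi S
    · have hrS : Real.sqrt S < r := by
        rw [← Real.sqrt_sq hr'.le]; exact Real.sqrt_lt_sqrt hS h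
      rw [indicator_of_mem h, indicator_of_mem (show r ∈ Ioi (Real.sqrt S) from hrS), ← ENNReal.ofReal_mul (sq_nonneg _)]
    · have hrS : ¬ Real.sqrt S < r := fun h' => h (by
        show S < r ^ 2
        have := pow_lt_pow_left₀ h' (Real.sqrt_nonneg S) two_ne_zero
        rwa [hsqrt] at this)
      rw [indicator_of_notMem h, indicator_of_notMem (show r ∉ Ioi (Real.sqrt S) from hrS), mul_zero]
  rw [setLIntegral_congr_fun measurableSet_Ioi hpt, lintegral_indicator measurableSet_Ioi, Measure.restrict_restrict measurableSet_Ioi,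
    show Ioi (Real.sqrt S) ∩ Ioi (0 : ℝ) = Ioi (Real.sqrt S) from Set.inter_eq_left.2 (Set.Ioi_subset_Ioi (Real.sqrt_nonneg S))]
  have hcont : Continuous fun r : ℝ => r ^ 2 * ((1 + r ^ 2)⁻¹) ^ 2 :=
    (continuous_pow 2).mul ((Continuous.inv₀ (by fun_prop) fun x => by positivity).pow 2)
  have hint : IntegrableOn (fun r : ℝ => r ^ 2 * ((1 + r ^ 2)⁻¹) ^ 2) (Ioi (Real.sqrt S)) := by
    refine (integrable_inv_one_add_sq.integrableOn).mono' hcont.aestronglyMeasurable (Filter.Eventually.of_forall fun r => ?_)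
    rw [Real.norm_eq_abs, abs_of_nonneg (by positivity)]
    exact cap_integrand_le r
  rw [← ofReal_integral_eq_lintegral_ofReal hint (Filter.Eventually.of_forall fun r => by positivity), integral_cap_Ioi, hsqrt]

/-- The whole gnomonic density: `∫_{ℝ³} (1+|v|²)⁻² dv = π²`. [folklore] -/
theorem lintegral_chart_density :
    ∫⁻ v : Fin 3 → ℝ, ENNReal.ofReal (((1 + ∑ i, v i ^ 2)⁻¹) ^ 2) = ENNReal.ofReal (Real.pi ^ 2) := by
  have hm : Measurable fun s : ℝ => ENNReal.ofReal (((1 + s)⁻¹) ^ 2) := ENNReal.measurable_ofReal.comp (by fun_prop)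
  rw [show (fun v : Fin 3 → ℝ => ENNReal.ofReal (((1 + ∑ i, v i ^ 2)⁻¹) ^ 2)) =
      fun v => (fun s : ℝ => ENNReal.ofReal (((1 + s)⁻¹) ^ 2)) (∑ i, v i ^ 2) from rfl, lintegral_chart_radial _ hm]
  have hcont : Continuous fun r : ℝ => r ^ 2 * ((1 + r ^ 2)⁻¹) ^ 2 :=
    (continuous_pow 2).mul ((Continuous.inv₀ (by fun_prop) fun x => by positivity).pow 2)
  have hint : IntegrableOn (fun r : ℝ => r ^ 2 * ((1 + r ^ 2)⁻¹) ^ 2) (Ioi (0 : ℝ)) := by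
    refine (integrable_inv_one_add_sq.integrableOn).mono' hcont.aestronglyMeasurable (Filter.Eventually.of_forall fun r => ?_)
    rw [Real.norm_eq_abs, abs_of_nonneg (by positivity)]
    exact cap_integrand_le r
  have hpt : ∀ r : ℝ, ENNReal.ofReal (r ^ 2) * ENNReal.ofReal (((1 + r ^ 2)⁻¹) ^ 2) = ENNReal.ofReal (r ^ 2 * ((1 + r ^ 2)⁻¹) ^ 2) :=
    fun r => by rw [← ENNReal.ofReal_mul (sq_nonneg _)]
  simp_rw [hpt]
  rw [← ofReal_integral_eq_lintegral_ofReal hint (Filter.Eventually.of_forall fun r => by positivity), integral_cap_Ioi,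
    Real.arctan_zero, ← ENNReal.ofReal_mul (by positivity)]
  congr 1; ring

/-! ## §25 Level sets of the real part are Haar-null -/

/-- `Haar{u | re(q u) = x} = 0` for every `x`. [folklore] -/
theorem haar_re_eq_null (x : ℝ) :
    haarProbability (Matrix.specialUnitaryGroup (Fin 2) ℂ) {u : Matrix.specialUnitaryGroup (Fin 2) ℂ | (su2Quat u).re = x} = 0 := by
  set T := {u : Matrix.specialUnitaryGroup (Fin 2) ℂ | (su2Quat u).re = x} with hT
  have hTm : MeasurableSet T := (isClosed_eq (Quaternion.continuous_re.comp continuous_su2Quat) continuous_const).measurableSet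
  have hmeas : Measurable (T.indicator (1 : Matrix.specialUnitaryGroup (Fin 2) ℂ → ℝ≥0∞)) := measurable_one.indicator hTm
  rw [← lintegral_indicator_one hTm, lintegral_haarProbability_su2_gnomonic _ hmeas]
  -- both chart points lie on the level set only if `|v|² = x⁻² − 1`
  set s₀ : ℝ := (x ^ 2)⁻¹ - 1 with hs₀
  have hmem : ∀ (v : Fin 3 → ℝ) (b : Bool), quatToSU2 (if b then gnomonicQuat v else -gnomonicQuat v) ∈ T → ∑ i, v i ^ 2 = s₀ := by
    intro v b hb
    rw [hT, Set.mem_setOf_eq, re_proj_gnomonic] at hb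
    have hpos : 0 < 1 + ∑ i, v i ^ 2 := by positivity
    have hsq : 0 < Real.sqrt (1 + ∑ i, v i ^ 2) := Real.sqrt_pos.2 hpos
    have hx2 : x ^ 2 = (1 + ∑ i, v i ^ 2)⁻¹ := by
      rw [← hb, mul_pow, inv_pow, Real.sq_sqrt hpos.le]
      cases b <;> simp
    rw [hs₀, hx2, inv_inv]; ring
  have hpt : ∀ v : Fin 3 → ℝ, (T.indicator (1 : Matrix.specialUnitaryGroup (Fin 2) ℂ → ℝ≥0∞) (quatToSU2 (gnomonicQuat v)) +
      T.indicator (1 : Matrix.specialUnitaryGroup (Fin 2) ℂ → ℝ≥0∞) (quatToSU2 (-gnomonicQuat v))) * ENNReal.ofReal (((1 + ∑ i, v i ^ 2)⁻¹) ^ 2) ≤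
      2 * ({s₀} : Set ℝ).indicator (fun _ => (1 : ℝ≥0∞)) (∑ i, v i ^ 2) := by
    intro v
    by_cases hv : ∑ i, v i ^ 2 = s₀
    · rw [indicator_of_mem (show ∑ i, v i ^ 2 ∈ ({s₀} : Set ℝ) from hv)]
      have hd : ENNReal.ofReal (((1 + ∑ i, v i ^ 2)⁻¹) ^ 2) ≤ 1 := by
        rw [← ENNReal.ofReal_one]; refine ENNReal.ofReal_le_ofReal ?_
        have : 1 ≤ 1 + ∑ i, v i ^ 2 := by linarith [Finset.sum_nonneg (fun i (_ : i ∈ Finset.univ) => sq_nonneg (v i))]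
        rw [inv_pow]; exact inv_le_one_of_one_le₀ (by nlinarith)
      have hi : ∀ u, T.indicator (1 : Matrix.specialUnitaryGroup (Fin 2) ℂ → ℝ≥0∞) u ≤ 1 := by
        intro u
        by_cases hu : u ∈ T
        · rw [indicator_of_mem hu, Pi.one_apply]
        · rw [indicator_of_notMem hu]; exact zero_le_one
      rw [mul_one]
      calc (T.indicator (1 : Matrix.specialUnitaryGroup (Fin 2) ℂ → ℝ≥0∞) (quatToSU2 (gnomonicQuat v)) +
            T.indicator (1 : Matrix.specialUnitaryGroup (Fin 2) ℂ → ℝ≥0∞) (quatToSU2 (-gnomonicQuat v))) *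
            ENNReal.ofReal (((1 + ∑ i, v i ^ 2)⁻¹) ^ 2)
          ≤ (1 + 1) * 1 := mul_le_mul' (add_le_add (hi _) (hi _)) hd
        _ = 2 := by norm_num
    · have h1 := fun h => hv (hmem v true (by simpa using h))
      have h2 := fun h => hv (hmem v false (by simpa using h))
      rw [indicator_of_notMem (show quatToSU2 (gnomonicQuat v) ∉ T from fun h => h1 h),
        indicator_of_notMem (show quatToSU2 (-gnomonicQuat v) ∉ T from fun h => h2 h), zero_add, zero_mul]
      exact zero_le
  -- the radial image of a single sphere is a finite set of radii
  have hmI : Measurable (({s₀} : Set ℝ).indicator (fun _ => (1 : ℝ≥0∞))) := measurable_const.indicator (measurableSet_singleton _)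
  have hrad : ∫⁻ v : Fin 3 → ℝ, ({s₀} : Set ℝ).indicator (fun _ => (1 : ℝ≥0∞)) (∑ i, v i ^ 2) = 0 := by
    rw [show (fun v : Fin 3 → ℝ => ({s₀} : Set ℝ).indicator (fun _ => (1 : ℝ≥0∞)) (∑ i, v i ^ 2)) =
        fun v => (({s₀} : Set ℝ).indicator (fun _ => (1 : ℝ≥0∞))) (∑ i, v i ^ 2) from rfl, lintegral_chart_radial _ hmI]
    have hnull : ∫⁻ r in Ioi (0 : ℝ), ENNReal.ofReal (r ^ 2) * ({s₀} : Set ℝ).indicator (fun _ => (1 : ℝ≥0∞)) (r ^ 2) = 0 := by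
      set F : Set ℝ := {Real.sqrt s₀, -Real.sqrt s₀} with hF
      have hFfin : F.Finite := by rw [hF]; exact Set.toFinite _
      have hF0 : volume F = 0 := hFfin.measure_zero volume
      have hsub : ∀ r : ℝ, r ^ 2 ∈ ({s₀} : Set ℝ) → r ∈ F := by
        intro r hr
        rw [Set.mem_singleton_iff] at hr
        have h : |r| = Real.sqrt s₀ := by rw [← hr, Real.sqrt_sq_eq_abs]
        rcases (abs_eq (Real.sqrt_nonneg s₀)).1 h with h1 | h1
        · rw [hF, h1]; exact Set.mem_insert _ _
        · rw [hF, h1]; exact Set.mem_insert_of_mem _ (Set.mem_singleton _)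
      have hle : ∀ r : ℝ, ENNReal.ofReal (r ^ 2) * ({s₀} : Set ℝ).indicator (fun _ => (1 : ℝ≥0∞)) (r ^ 2) ≤
          F.indicator (fun r => ENNReal.ofReal (r ^ 2)) r := by
        intro r
        by_cases h : r ^ 2 ∈ ({s₀} : Set ℝ)
        · rw [indicator_of_mem h, mul_one, indicator_of_mem (hsub r h)]
        · rw [indicator_of_notMem h, mul_zero]; exact zero_le
      refine le_antisymm ?_ bot_le
      calc ∫⁻ r in Ioi (0 : ℝ), ENNReal.ofReal (r ^ 2) * ({s₀} : Set ℝ).indicator (fun _ => (1 : ℝ≥0∞)) (r ^ 2)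
          ≤ ∫⁻ r in Ioi (0 : ℝ), F.indicator (fun r => ENNReal.ofReal (r ^ 2)) r := lintegral_mono hle
        _ ≤ ∫⁻ r, F.indicator (fun r => ENNReal.ofReal (r ^ 2)) r := setLIntegral_le_lintegral _ _
        _ = ∫⁻ r in F, ENNReal.ofReal (r ^ 2) := lintegral_indicator hFfin.measurableSet _
        _ = 0 := setLIntegral_measure_zero _ _ hF0
    rw [hnull, mul_zero]
  refine le_antisymm ?_ bot_le
  calc _ ≤ ENNReal.ofReal (1 / (2 * Real.pi ^ 2)) * ∫⁻ v : Fin 3 → ℝ, 2 * ({s₀} : Set ℝ).indicator (fun _ => (1 : ℝ≥0∞)) (∑ i, v i ^ 2) :=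
        mul_le_mul_right (lintegral_mono hpt) _
    _ = 0 := by
        have hm2 : Measurable fun v : Fin 3 → ℝ => ({s₀} : Set ℝ).indicator (fun _ => (1 : ℝ≥0∞)) (∑ i, v i ^ 2) :=
          hmI.comp (by fun_prop)
        rw [lintegral_const_mul _ hm2, hrad, mul_zero, mul_zero]

/-! ## §26 ★★ The distribution function of `re(q u)` on all of `ℝ` -/

/-- The open cap `{x < re q u}` is measurable. [folklore] -/
theorem measurableSet_reCap_lt (x : ℝ) : MeasurableSet {u : Matrix.specialUnitaryGroup (Fin 2) ℂ | x < (su2Quat u).re} :=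
  measurableSet_lt measurable_const (Quaternion.continuous_re.comp continuous_su2Quat).measurable

/-- Regime `x < 0`, `−1 ≤ x`: `Haar{x < re q u} = (arccos x − x√(1−x²))/π` — upper hemisphere entirely, lower hemisphere off the cap `|v|² > (1−x²)/x²`.
[folklore] -/
theorem haar_re_gt_eq_of_neg {x : ℝ} (hx : x < 0) (hx1 : -1 ≤ x) :
    haarProbability (Matrix.specialUnitaryGroup (Fin 2) ℂ) {u : Matrix.specialUnitaryGroup (Fin 2) ℂ | x < (su2Quat u).re} =
      ENNReal.ofReal ((Real.arccos x - x * Real.sqrt (1 - x ^ 2)) / Real.pi) := by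
  set T := {u : Matrix.specialUnitaryGroup (Fin 2) ℂ | x < (su2Quat u).re} with hT
  set S : ℝ := (1 - x ^ 2) / x ^ 2 with hSdef
  have hx0 : x ≠ 0 := hx.ne
  have hx2 : 0 < x ^ 2 := by positivity
  have hS : 0 ≤ S := div_nonneg (by nlinarith) hx2.le
  have hmeas : Measurable (T.indicator (1 : Matrix.specialUnitaryGroup (Fin 2) ℂ → ℝ≥0∞)) := measurable_one.indicator (measurableSet_reCap_lt x)
  rw [← lintegral_indicator_one (measurableSet_reCap_lt x), lintegral_haarProbability_su2_gnomonic _ hmeas]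
  have hpt : ∀ v : Fin 3 → ℝ, (T.indicator (1 : Matrix.specialUnitaryGroup (Fin 2) ℂ → ℝ≥0∞) (quatToSU2 (gnomonicQuat v)) +
      T.indicator (1 : Matrix.specialUnitaryGroup (Fin 2) ℂ → ℝ≥0∞) (quatToSU2 (-gnomonicQuat v))) * ENNReal.ofReal (((1 + ∑ i, v i ^ 2)⁻¹) ^ 2) =
      ENNReal.ofReal (((1 + ∑ i, v i ^ 2)⁻¹) ^ 2) +
        (Set.Ioi S).indicator (fun s : ℝ => ENNReal.ofReal (((1 + s)⁻¹) ^ 2)) (∑ i, v i ^ 2) := by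
    intro v
    have hpos : 0 < 1 + ∑ i, v i ^ 2 := by positivity
    have hsq : 0 < Real.sqrt (1 + ∑ i, v i ^ 2) := Real.sqrt_pos.2 hpos
    have hp := re_proj_gnomonic v true
    have hm := re_proj_gnomonic v false
    simp only [↓reduceIte, Bool.false_eq_true, one_mul, neg_mul, one_mul] at hp hm
    -- the upper point is always in `T`
    have hup : quatToSU2 (gnomonicQuat v) ∈ T := by
      rw [hT, Set.mem_setOf_eq, hp]; exact hx.trans (inv_pos.2 hsq)
    -- the lower point is in `T` iff `|v|² > S`
    have hlow : quatToSU2 (-gnomonicQuat v) ∈ T ↔ ∑ i, v i ^ 2 ∈ Set.Ioi S := by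
      rw [hT, Set.mem_setOf_eq, hm, Set.mem_Ioi, hSdef, div_lt_iff₀ hx2, lt_neg, inv_lt_comm₀ hsq (by linarith),
        show (-x)⁻¹ = Real.sqrt ((x ^ 2)⁻¹) by rw [Real.sqrt_inv, Real.sqrt_sq_eq_abs, abs_of_neg hx],
        Real.sqrt_lt_sqrt_iff (by positivity), ← one_div, div_lt_iff₀ hx2]
      constructor <;> intro h <;> nlinarith
    rw [indicator_of_mem hup, Pi.one_apply]
    by_cases hv : ∑ i, v i ^ 2 ∈ Set.Ioi S
    · rw [indicator_of_mem (hlow.2 hv), Pi.one_apply, indicator_of_mem hv]; ring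
    · rw [indicator_of_notMem (fun h => hv (hlow.1 h)), indicator_of_notMem hv]; ring
  simp_rw [hpt]
  have hm1 : Measurable fun v : Fin 3 → ℝ => ENNReal.ofReal (((1 + ∑ i, v i ^ 2)⁻¹) ^ 2) := ENNReal.measurable_ofReal.comp (by fun_prop)
  have hmI : Measurable ((Set.Ioi S).indicator (fun s : ℝ => ENNReal.ofReal (((1 + s)⁻¹) ^ 2))) :=
    (ENNReal.measurable_ofReal.comp (by fun_prop)).indicator measurableSet_Ioi
  rw [lintegral_add_left hm1, lintegral_chart_density,
    show (fun v : Fin 3 → ℝ => (Set.Ioi S).indicator (fun s : ℝ => ENNReal.ofReal (((1 + s)⁻¹) ^ 2)) (∑ i, v i ^ 2)) =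
      fun v => ((Set.Ioi S).indicator (fun s : ℝ => ENNReal.ofReal (((1 + s)⁻¹) ^ 2))) (∑ i, v i ^ 2) from rfl,
    lintegral_chart_radial _ hmI, lintegral_tail_cutoff hS]
  -- identify `√S`, `arctan √S`, `√S/(1+S)` in terms of `x`
  have hsqrtS : Real.sqrt S = Real.sqrt (1 - x ^ 2) / (-x) := by
    rw [hSdef, show x ^ 2 = (-x) ^ 2 by ring, Real.sqrt_div (by nlinarith), Real.sqrt_sq (by linarith)]
  have harc : Real.arctan (Real.sqrt S) = Real.pi - Real.arccos x := by
    rw [hsqrtS, show 1 - x ^ 2 = 1 - (-x) ^ 2 by ring, ← Real.arccos_eq_arctan (by linarith), Real.arccos_neg]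
  have h1S : 1 + S = (x ^ 2)⁻¹ := by rw [hSdef]; field_simp; ring
  have hfrac : Real.sqrt S * (1 + S)⁻¹ = -(x * Real.sqrt (1 - x ^ 2)) := by
    rw [h1S, inv_inv, hsqrtS]; field_simp
  have hcap : 0 ≤ Real.pi / 4 - (Real.arctan (Real.sqrt S) - Real.sqrt S * (1 + S)⁻¹) / 2 := by
    have h := integral_cap_Ioi (Real.sqrt S)
    have hnn : 0 ≤ ∫ r in Ioi (Real.sqrt S), r ^ 2 * ((1 + r ^ 2)⁻¹) ^ 2 := setIntegral_nonneg measurableSet_Ioi fun r _ => by positivity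
    rw [h, Real.sq_sqrt hS] at hnn
    exact hnn
  rw [← ENNReal.ofReal_mul (by positivity), ← ENNReal.ofReal_add (by positivity) (by positivity), ← ENNReal.ofReal_mul (by positivity),
    harc, hfrac]
  congr 1
  field_simp
  ring

/-- Regime `x = 0`: `Haar{0 < re q u} = 1/2`. [folklore] -/
theorem haar_re_pos_eq : haarProbability (Matrix.specialUnitaryGroup (Fin 2) ℂ) {u : Matrix.specialUnitaryGroup (Fin 2) ℂ | 0 < (su2Quat u).re} =
    ENNReal.ofReal (1 / 2) := by
  set T := {u : Matrix.specialUnitaryGroup (Fin 2) ℂ | 0 < (su2Quat u).re} with hT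
  have hmeas : Measurable (T.indicator (1 : Matrix.specialUnitaryGroup (Fin 2) ℂ → ℝ≥0∞)) := measurable_one.indicator (measurableSet_reCap_lt 0)
  rw [← lintegral_indicator_one (measurableSet_reCap_lt 0), lintegral_haarProbability_su2_gnomonic _ hmeas]
  have hpt : ∀ v : Fin 3 → ℝ, (T.indicator (1 : Matrix.specialUnitaryGroup (Fin 2) ℂ → ℝ≥0∞) (quatToSU2 (gnomonicQuat v)) +
      T.indicator (1 : Matrix.specialUnitaryGroup (Fin 2) ℂ → ℝ≥0∞) (quatToSU2 (-gnomonicQuat v))) * ENNReal.ofReal (((1 + ∑ i, v i ^ 2)⁻¹) ^ 2) =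
      ENNReal.ofReal (((1 + ∑ i, v i ^ 2)⁻¹) ^ 2) := by
    intro v
    have hsq : 0 < Real.sqrt (1 + ∑ i, v i ^ 2) := Real.sqrt_pos.2 (by positivity)
    have hp := re_proj_gnomonic v true
    have hm := re_proj_gnomonic v false
    simp only [↓reduceIte, Bool.false_eq_true, one_mul, neg_mul, one_mul] at hp hm
    have hup : quatToSU2 (gnomonicQuat v) ∈ T := by rw [hT, Set.mem_setOf_eq, hp]; exact inv_pos.2 hsq
    have hlow : quatToSU2 (-gnomonicQuat v) ∉ T := by
      rw [hT, Set.mem_setOf_eq, hm, not_lt]; exact neg_nonpos.2 (inv_pos.2 hsq).le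
    rw [indicator_of_mem hup, indicator_of_notMem hlow, Pi.one_apply, add_zero, one_mul]
  simp_rw [hpt]
  rw [lintegral_chart_density, ← ENNReal.ofReal_mul (by positivity)]
  congr 1; field_simp

/-- ★★ **`Haar{u | x < re(q u)} = (arccos x − x·√(1−x²))/π` FOR EVERY REAL `x`** (Mathlib conventions: `arccos x = π` for `x ≤ −1`, `= 0` for
`x ≥ 1`, `√(negative) = 0`). [folklore] -/
theorem haar_re_gt_eq_ofReal (x : ℝ) :
    haarProbability (Matrix.specialUnitaryGroup (Fin 2) ℂ) {u : Matrix.specialUnitaryGroup (Fin 2) ℂ | x < (su2Quat u).re} =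
      ENNReal.ofReal ((Real.arccos x - x * Real.sqrt (1 - x ^ 2)) / Real.pi) := by
  rcases lt_or_ge x (-1) with hlt | hge
  · -- `x < −1`: everything
    have hall : {u : Matrix.specialUnitaryGroup (Fin 2) ℂ | x < (su2Quat u).re} = Set.univ :=
      Set.eq_univ_of_forall fun u => by
        have h := abs_re_le_norm (su2Quat u)
        rw [norm_su2Quat] at h
        exact hlt.trans_le (abs_le.1 h).1
    rw [hall, measure_univ, Real.arccos_of_le_neg_one hlt.le, Real.sqrt_eq_zero'.2 (by nlinarith), mul_zero, sub_zero,
      div_self Real.pi_pos.ne', ENNReal.ofReal_one]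
  rcases lt_trichotomy x 0 with hneg | hzero | hpos
  · exact haar_re_gt_eq_of_neg hneg hge
  · subst hzero
    rw [haar_re_pos_eq, Real.arccos_zero, zero_mul, sub_zero]
    congr 1; field_simp
  rcases le_or_gt x 1 with hle1 | hgt1
  · -- `0 < x ≤ 1`: the open cap has the mass of the closed cap
    have hsub : {u : Matrix.specialUnitaryGroup (Fin 2) ℂ | x < (su2Quat u).re} ⊆ {u | x ≤ (su2Quat u).re} := fun u hu => by
      simp only [Set.mem_setOf_eq] at hu ⊢; exact le_of_lt hu
    have hdiff : {u : Matrix.specialUnitaryGroup (Fin 2) ℂ | x ≤ (su2Quat u).re} \ {u | x < (su2Quat u).re} ⊆ {u | (su2Quat u).re = x} := by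
      intro u hu
      rw [Set.mem_sdiff, Set.mem_setOf_eq, Set.mem_setOf_eq, not_lt] at hu
      exact le_antisymm hu.2 hu.1
    have hnull : haarProbability (Matrix.specialUnitaryGroup (Fin 2) ℂ)
        ({u : Matrix.specialUnitaryGroup (Fin 2) ℂ | x ≤ (su2Quat u).re} \ {u | x < (su2Quat u).re}) = 0 :=
      measure_mono_null hdiff (haar_re_eq_null x)
    rw [← haar_re_ge_eq_ofReal hpos hle1]
    exact measure_eq_measure_of_null_sdiff hsub hnull
  · -- `x > 1`: nothing
    have hempty : {u : Matrix.specialUnitaryGroup (Fin 2) ℂ | x < (su2Quat u).re} = ∅ :=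
      Set.eq_empty_of_forall_notMem fun u hu => by
        have h := abs_re_le_norm (su2Quat u)
        rw [norm_su2Quat] at h
        have := (abs_le.1 h).2
        exact absurd (hu.trans_le this) (not_lt.2 hgt1.le)
    rw [hempty, measure_empty, Real.arccos_of_one_le hgt1.le, Real.sqrt_eq_zero'.2 (by nlinarith), mul_zero, sub_zero, zero_div,
      ENNReal.ofReal_zero]

/-! ## §27 ★★ The semicircle distribution function -/

/-- `x·√(1−x²) ≤ arccos x` for every real `x`. [folklore] -/
theorem mul_sqrt_le_arccos (x : ℝ) : x * Real.sqrt (1 - x ^ 2) ≤ Real.arccos x := by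
  rcases le_or_gt x 0 with hx | hx
  · exact (mul_nonpos_of_nonpos_of_nonneg hx (Real.sqrt_nonneg _)).trans (Real.arccos_nonneg x)
  rcases le_or_gt x 1 with hx1 | hx1
  · -- `0 < x ≤ 1`: the cap integral is nonnegative
    have hS : 0 ≤ (1 - x ^ 2) / x ^ 2 := div_nonneg (by nlinarith) (sq_nonneg _)
    have hI := integral_cap (Real.sqrt ((1 - x ^ 2) / x ^ 2))
    have hnn : 0 ≤ ∫ r in (0 : ℝ)..Real.sqrt ((1 - x ^ 2) / x ^ 2), r ^ 2 * ((1 + r ^ 2)⁻¹) ^ 2 :=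
      intervalIntegral.integral_nonneg (Real.sqrt_nonneg _) fun r _ => by positivity
    rw [hI, Real.sq_sqrt hS] at hnn
    have hsqrtS : Real.sqrt ((1 - x ^ 2) / x ^ 2) = Real.sqrt (1 - x ^ 2) / x := by
      rw [Real.sqrt_div (by nlinarith), Real.sqrt_sq hx.le]
    have harc : Real.arctan (Real.sqrt ((1 - x ^ 2) / x ^ 2)) = Real.arccos x := by rw [hsqrtS, ← Real.arccos_eq_arctan hx]
    have hx0 : x ≠ 0 := hx.ne'
    have h1S : 1 + (1 - x ^ 2) / x ^ 2 = (x ^ 2)⁻¹ := by field_simp; ring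
    have hfrac : Real.sqrt ((1 - x ^ 2) / x ^ 2) * (1 + (1 - x ^ 2) / x ^ 2)⁻¹ = x * Real.sqrt (1 - x ^ 2) := by
      rw [h1S, inv_inv, hsqrtS]; field_simp
    rw [harc, hfrac] at hnn
    linarith
  · rw [Real.arccos_of_one_le hx1.le, Real.sqrt_eq_zero'.2 (by nlinarith), mul_zero]

/-- ★★ **`Haar.real{u | x < re(q u)} = (arccos x − x√(1−x²))/π`** for every real `x`. [folklore] -/
theorem haar_re_gt_eq (x : ℝ) :
    (haarProbability (Matrix.specialUnitaryGroup (Fin 2) ℂ)).real {u : Matrix.specialUnitaryGroup (Fin 2) ℂ | x < (su2Quat u).re} =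
      (Real.arccos x - x * Real.sqrt (1 - x ^ 2)) / Real.pi := by
  rw [measureReal_def, haar_re_gt_eq_ofReal x,
    ENNReal.toReal_ofReal (div_nonneg (by linarith [mul_sqrt_le_arccos x]) Real.pi_pos.le)]

/-- ★★ **THE SEMICIRCLE DISTRIBUTION FUNCTION**: `Haar.real{u | re(q u) ≤ x} = 1 − (arccos x − x√(1−x²))/π` for every real `x`
(with `x = cos φ`: `1 − (φ − sin φ cos φ)/π`, the law of `cos Θ`, `Θ ∼ (2/π) sin²θ dθ` on `[0,π]`). [folklore] -/
theorem haar_re_le_eq (x : ℝ) :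
    (haarProbability (Matrix.specialUnitaryGroup (Fin 2) ℂ)).real {u : Matrix.specialUnitaryGroup (Fin 2) ℂ | (su2Quat u).re ≤ x} =
      1 - (Real.arccos x - x * Real.sqrt (1 - x ^ 2)) / Real.pi := by
  have hc : {u : Matrix.specialUnitaryGroup (Fin 2) ℂ | (su2Quat u).re ≤ x} = {u | x < (su2Quat u).re}ᶜ := by
    ext u; simp only [Set.mem_setOf_eq, Set.mem_compl_iff, not_lt]
  rw [hc, measureReal_def, prob_compl_eq_one_sub (measurableSet_reCap_lt x), ENNReal.toReal_sub_of_le (prob_le_one) ENNReal.one_ne_top,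
    ENNReal.toReal_one, ← measureReal_def, haar_re_gt_eq]

end Summit.QuantumFields.YangMills.Theorems.SwapVirialDeficit.ZeroModeExact

end
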